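import Summits.HodgeConjecture.CorCM.Census.SexticDecicWeilParts
import HarnessLib

/-!
# `E × T × B` over a sextic and a decic CM field sharing `k`: the composite parts SPLIT into curve points, three parts and five parts,
# and every part is BALANCED at every pair of permutations

COR-CM (cell `pub-hodgecm2`), seat b30 gen 27 (2026-08-23); count-neutral own lane SEXTIC-DECIC, sequel of
`Census/SexticDecicWeilParts.lean` (the part predicates `IsPairPartSD`, `IsThreePartSD`, `IsFivePartSD`, `IsFourPartSD`, `IsSixPartSD`,
`IsEightPartSD` and their count functions); the degree-`(6,10)` twin of gen 26ʼs `Census/SexticOcticWeilPartsBalanced.lean`.  Theorems of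
the finite model only; no definition, no named fact, no geometry, no `sorry`, no `decide`.

* §1 `IsFourPartSD.exists_split` (curve point + three part), `IsSixPartSD.exists_split` (curve point + five part),
  `IsEightPartSD.exists_split` (three part of sign `b` + five part of sign `¬b`);
* §2 **balance at EVERY pair of permutations** via the defect law `Census/SexticDecicWeilDefect.balancedSD_of_defect`, with defects
  `(t₁, t₃; e) = (0, 0; 0)` (pair), `(±1, 0; ±1)` (four: the Weil class of `T × E`), `(0, ±1; ±1)` (six: `B × E`), `(±1, ∓1; 0)`
  (eight: `T × B̄`) — so removing a part from a balanced configuration keeps it balanced, whatever the realised set `R`.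
[cite: MoonenZarhin1995Duke, Thm. 2.4] [cite: Gordon1999HodgeAVSurvey, 5.13 (ii), 9.2.2] [cite: Milne2020HodgeClassesAV, 1.2 (a)]

## References
* [MoonenZarhin1995Duke] B. Moonen, Yu. Zarhin, Duke Math. J. 77 (1995), Thm. 2.4.  [Gordon1999HodgeAVSurvey] B. B. Gordon, CRM
  Monogr. 10 (1999), 5.13 (ii), 9.2.2.  [Milne2020HodgeClassesAV] J. S. Milne, arXiv:2010.08857, 1.2 (a).
-/

namespace Summit.HodgeConjecture.CorCM.Census.SexticDecicWeil

open Finset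

variable {α : Type*} {v : α → PtSD}

/-! ### Splitting the composite parts -/

/-- A four part is its curve point plus a three part. [folklore] -/
theorem IsFourPartSD.exists_split [DecidableEq α] {b : Bool} {G : Finset α} (hG : IsFourPartSD v b G) :
    ∃ (x : α) (G₁ : Finset α), x ∉ G₁ ∧ G = insert x G₁ ∧ v x = Sum.inl b ∧ IsThreePartSD v b G₁ := by
  obtain ⟨x, hxf⟩ := Finset.card_eq_one.1 hG.2.1
  have hx : x ∈ G.filter fun x => v x = Sum.inl b := by rw [hxf]; exact Finset.mem_singleton_self x
  obtain ⟨hxG, hvx⟩ := Finset.mem_filter.1 hx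
  obtain ⟨W, hW, hW'⟩ := exists_threePartSD_of_counts (v := v) (T := G) b fun a => by rw [hG.2.2 a]; exact one_pos
  have hxW : x ∉ W := fun h => by
    obtain ⟨a, ha⟩ := hW'.exists_eq h
    rw [hvx] at ha; exact Sum.inl_ne_inr ha
  refine ⟨x, W, hxW, ?_, hvx, hW'⟩
  symm
  apply Finset.eq_of_subset_of_card_le (Finset.insert_subset hxG hW)
  rw [Finset.card_insert_of_notMem hxW, hW'.1, hG.1]

/-- A six part is its curve point plus a five part. [folklore] -/
theorem IsSixPartSD.exists_split [DecidableEq α] {b : Bool} {G : Finset α} (hG : IsSixPartSD v b G) :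
    ∃ (x : α) (G₁ : Finset α), x ∉ G₁ ∧ G = insert x G₁ ∧ v x = Sum.inl b ∧ IsFivePartSD v b G₁ := by
  obtain ⟨x, hxf⟩ := Finset.card_eq_one.1 hG.2.1
  have hx : x ∈ G.filter fun x => v x = Sum.inl b := by rw [hxf]; exact Finset.mem_singleton_self x
  obtain ⟨hxG, hvx⟩ := Finset.mem_filter.1 hx
  obtain ⟨W, hW, hW'⟩ := exists_fivePartSD_of_counts (v := v) (T := G) b fun a => by rw [hG.2.2 a]; exact one_pos
  have hxW : x ∉ W := fun h => by
    obtain ⟨a, ha⟩ := hW'.exists_eq h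
    rw [hvx] at ha; exact Sum.inl_ne_inr ha
  refine ⟨x, W, hxW, ?_, hvx, hW'⟩
  symm
  apply Finset.eq_of_subset_of_card_le (Finset.insert_subset hxG hW)
  rw [Finset.card_insert_of_notMem hxW, hW'.1, hG.1]

/-- An eight part is a three part of sign `b` and a five part of sign `¬b`. [folklore] -/
theorem IsEightPartSD.exists_split [DecidableEq α] {b : Bool} {G : Finset α} (hG : IsEightPartSD v b G) :
    ∃ (G₁ G₂ : Finset α), Disjoint G₁ G₂ ∧ G = G₁ ∪ G₂ ∧ IsThreePartSD v b G₁ ∧ IsFivePartSD v (!b) G₂ := by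
  obtain ⟨W₁, hW₁, hW₁'⟩ := exists_threePartSD_of_counts (v := v) (T := G) b fun a => by rw [hG.2.1 a]; exact one_pos
  obtain ⟨W₂, hW₂, hW₂'⟩ := exists_fivePartSD_of_counts (v := v) (T := G) (!b) fun a => by rw [hG.2.2 a]; exact one_pos
  have hW : Disjoint W₁ W₂ := by
    rw [Finset.disjoint_left]
    intro z hz1 hz2
    obtain ⟨a, ha⟩ := hW₁'.exists_eq hz1
    obtain ⟨a', ha'⟩ := hW₂'.exists_eq hz2
    have := ha.symm.trans ha'
    simp at this
  refine ⟨W₁, W₂, hW, ?_, hW₁', hW₂'⟩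
  symm
  apply Finset.eq_of_subset_of_card_le (Finset.union_subset hW₁ hW₂)
  rw [Finset.card_union_of_disjoint hW, hW₁'.1, hW₂'.1, hG.1]

/-! ### The parts are balanced at every pair of permutations -/

section Balanced

/-- **A pair part is balanced** (its count function is conjugation-invariant, so all defects vanish).
[cite: Gordon1999HodgeAVSurvey, 9.2.2] -/
theorem IsPairPartSD.balancedSD [DecidableEq α] {G : Finset α} (hG : IsPairPartSD v G)
    (π : Equiv.Perm (Fin 3) × Equiv.Perm (Fin 5)) : 2 * (G.filter fun x => v x ∈ phiSD π).card = G.card := by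
  obtain ⟨y, hy⟩ := hG.count_eq
  have hsymm : ∀ z : PtSD, (G.filter fun x => v x = cjSD z).card = (G.filter fun x => v x = z).card := by
    intro z
    rw [hy, hy]
    have h1 : cjSD z = y ↔ z = cjSD y := ⟨fun h => by rw [← h, cjSD_cjSD], fun h => by rw [h, cjSD_cjSD]⟩
    have h2 : cjSD z = cjSD y ↔ z = y := ⟨fun h => by rw [← cjSD_cjSD z, h, cjSD_cjSD], fun h => by rw [h]⟩
    simp only [h1, h2, or_comm]
  refine balancedSD_of_defect (v := v) (t₁ := 0) (t₃ := 0) (fun a => ?_) (fun a => ?_) ?_ π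
  · have h := hsymm (Sum.inr (Sum.inl (a, true)))
    rw [cjSD_inr_inl, Bool.not_true] at h
    rw [h, sub_self]
  · have h := hsymm (Sum.inr (Sum.inr (a, true)))
    rw [cjSD_inr_inr, Bool.not_true] at h
    rw [h, sub_self]
  · have h := hsymm (Sum.inl true)
    rw [cjSD_inl, Bool.not_true] at h
    rw [h, sub_self]; ring

/-- **A four part is balanced** (defects `(t₁, t₃; e) = (±1, 0; ±1)`: the Weil class of `T × E` is a Hodge class for every conjugate
type). [cite: MoonenZarhin1995Duke, Thm. 2.4] -/
theorem IsFourPartSD.balancedSD [DecidableEq α] {b : Bool} {G : Finset α} (hG : IsFourPartSD v b G)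
    (π : Equiv.Perm (Fin 3) × Equiv.Perm (Fin 5)) : 2 * (G.filter fun x => v x ∈ phiSD π).card = G.card := by
  obtain ⟨x, G₁, hxG₁, rfl, hvx, hG₁⟩ := hG.exists_split
  have hcount : ∀ z : PtSD, ((insert x G₁).filter fun x => v x = z).card =
      (if z = Sum.inl b then 1 else 0) + (G₁.filter fun x => v x = z).card := fun z => by
    rw [Finset.filter_insert, hvx]
    by_cases hz : Sum.inl b = z
    · rw [if_pos hz, if_pos hz.symm, Finset.card_insert_of_notMem fun h => hxG₁ (Finset.mem_of_mem_filter _ h), add_comm]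
    · rw [if_neg hz, if_neg (Ne.symm hz), zero_add]
  refine balancedSD_of_defect (v := v) (t₁ := if b then 1 else -1) (t₃ := 0) (fun a => ?_) (fun a => ?_) ?_ π
  · rw [hcount, hcount, hG₁.card_filter_inr_inl, hG₁.card_filter_inr_inl, if_neg Sum.inr_ne_inl, if_neg Sum.inr_ne_inl]
    cases b <;> simp
  · rw [hcount, hcount, hG₁.card_filter_inr_inr, hG₁.card_filter_inr_inr, if_neg Sum.inr_ne_inl, if_neg Sum.inr_ne_inl]
    simp
  · rw [hcount, hcount, hG₁.card_filter_inl, hG₁.card_filter_inl]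
    cases b <;> simp

/-- **A six part is balanced** (defects `(0, ±1; ±1)`: the Weil class of `B × E`). [cite: MoonenZarhin1995Duke, Thm. 2.4] -/
theorem IsSixPartSD.balancedSD [DecidableEq α] {b : Bool} {G : Finset α} (hG : IsSixPartSD v b G)
    (π : Equiv.Perm (Fin 3) × Equiv.Perm (Fin 5)) : 2 * (G.filter fun x => v x ∈ phiSD π).card = G.card := by
  obtain ⟨x, G₁, hxG₁, rfl, hvx, hG₁⟩ := hG.exists_split
  have hcount : ∀ z : PtSD, ((insert x G₁).filter fun x => v x = z).card =
      (if z = Sum.inl b then 1 else 0) + (G₁.filter fun x => v x = z).card := fun z => by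
    rw [Finset.filter_insert, hvx]
    by_cases hz : Sum.inl b = z
    · rw [if_pos hz, if_pos hz.symm, Finset.card_insert_of_notMem fun h => hxG₁ (Finset.mem_of_mem_filter _ h), add_comm]
    · rw [if_neg hz, if_neg (Ne.symm hz), zero_add]
  refine balancedSD_of_defect (v := v) (t₁ := 0) (t₃ := if b then 1 else -1) (fun a => ?_) (fun a => ?_) ?_ π
  · rw [hcount, hcount, hG₁.card_filter_inr_inl, hG₁.card_filter_inr_inl, if_neg Sum.inr_ne_inl, if_neg Sum.inr_ne_inl]
    simp
  · rw [hcount, hcount, hG₁.card_filter_inr_inr, hG₁.card_filter_inr_inr, if_neg Sum.inr_ne_inl, if_neg Sum.inr_ne_inl]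
    cases b <;> simp
  · rw [hcount, hcount, hG₁.card_filter_inl, hG₁.card_filter_inl]
    cases b <;> simp

/-- **An eight part is balanced** (defects `(±1, ∓1; 0)`: the Weil class of `T × B̄`). [cite: MoonenZarhin1995Duke, Thm. 2.4] -/
theorem IsEightPartSD.balancedSD [DecidableEq α] {b : Bool} {G : Finset α} (hG : IsEightPartSD v b G)
    (π : Equiv.Perm (Fin 3) × Equiv.Perm (Fin 5)) : 2 * (G.filter fun x => v x ∈ phiSD π).card = G.card := by
  obtain ⟨G₁, G₂, h12, rfl, hG₁, hG₂⟩ := hG.exists_split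
  have hcount : ∀ z : PtSD, ((G₁ ∪ G₂).filter fun x => v x = z).card =
      (G₁.filter fun x => v x = z).card + (G₂.filter fun x => v x = z).card := fun z => by
    rw [Finset.filter_union, Finset.card_union_of_disjoint (Finset.disjoint_filter_filter h12)]
  refine balancedSD_of_defect (v := v) (t₁ := if b then 1 else -1) (t₃ := if b then -1 else 1) (fun a => ?_) (fun a => ?_) ?_ π
  · rw [hcount, hcount, hG₁.card_filter_inr_inl, hG₁.card_filter_inr_inl, hG₂.card_filter_inr_inl, hG₂.card_filter_inr_inl]
    cases b <;> simp
  · rw [hcount, hcount, hG₁.card_filter_inr_inr, hG₁.card_filter_inr_inr, hG₂.card_filter_inr_inr, hG₂.card_filter_inr_inr]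
    cases b <;> simp
  · rw [hcount, hcount, hG₁.card_filter_inl, hG₁.card_filter_inl, hG₂.card_filter_inl, hG₂.card_filter_inl]
    cases b <;> simp

end Balanced

end Summit.HodgeConjecture.CorCM.Census.SexticDecicWeil
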